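import Summits.Langlands.Langlands.Theses.IrreducibilityBySelfDuality
import Literature.NumberTheory.Automorphic.ReciprocityGLnRankOneProofs
import Literature.NumberTheory.Automorphic.AlgebraicityParityGL
import Literature.NumberTheory.Automorphic.AutomorphicRepsGLSatakeFlathProofs
import Literature.NumberTheory.Automorphic.GLOneOfHeckeCharacterBJ
import Literature.NumberTheory.Automorphic.GLOneArchParameterOfAlgebraicCharacter
import Literature.NumberTheory.GaloisRepresentations.HeckeCharacterGaloisAvatarProofs
import Literature.NumberTheory.GaloisRepresentations.WeakAbelianDirectSummandProofs

/-!
# `ReciprocityUpToIrreducibility` (item stmt-Langlands-14328): the rank-one Satake content, proved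

Support file for the item `E := ReciprocityUpToIrreducibility` of route `IrreducibilityBySelfDuality`
("the rest of the mountain": the summit `Langlands` minus irreducibility/uniqueness — an open
problem for general `n`).  Nothing here closes the item.  What IS provable today is recorded, in the
summit's own vocabulary (`Summit.Langlands.SatakeFrobCompatibleAt`, `CuspidalAutomorphicRepData 1`,
`AutomorphicRepData.IsLAlgebraic`, `FramedGaloisRep K (PadicAlgCl ℓ) 1`), for `n = 1` and the
unramified (Satake–Frobenius) clause of `Corresponds`:

* `exists_satakeFrobCompatible_rankOne` — **direction (A') at `n = 1`, Satake half**: every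
  L-algebraic cuspidal `π` of `GL₁(𝔸_K)` (any number field `K`) has, for every `ℓ` and
  `ι : ℚ̄_ℓ ≃+* ℂ`, an `ℓ`-adic character `ρ : Γ_K → GL₁(ℚ̄_ℓ)` with
  `SatakeFrobCompatibleAt ι π ρ v` at all but finitely many `v` (hence `ρ` unramified almost
  everywhere, the first clause of `IsGeometricFramed`).  This is Weil's theorem (1956) on the
  `ℓ`-adic characters of Hecke characters of type `A₀`, proved in the tree
  (`HeckeCharacter.IsAlgebraic.exists_lAdic`), read through the rank-one dictionary
  "L-algebraic automorphic representations of `GL(1)` = algebraic Hecke characters"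
  (`AutomorphicRepData.exists_heckeCharacter_glOne`,
  `isAlgebraic_heckeCharacter_glOne_of_isCAlgebraic`; for `n = 1` L- and C-algebraic coincide,
  `IsLAlgebraic.isCAlgebraic_of_odd`) and Flath's theorem (`hasSatakeParamAt_cofinite_holds`).
* `exists_cuspidal_satakeFrobCompatible_rankOne_of_isOpen_ker` — **direction (B) at `n = 1` for
  characters with open kernel (finite image), Satake half**: for every continuous
  `ρ : Γ_K → GL₁(ℚ̄_ℓ)` with open kernel there is an L-algebraic cuspidal `π` of `GL₁(𝔸_K)` with
  `SatakeFrobCompatibleAt ι π ρ v` at all but finitely many `v`.  This is Artin's reciprocity law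
  for characters — proved in the tree (`artinReciprocity_character_holds`, the tree's global class
  field theory) — applied to the Artin character `(ι ∘ det ρ)⁻¹`, whose finite-order Hecke
  character `ω` gives `π = ℂ·(ω ∘ det)/⊥` (`exists_automorphicRepData_detTwist_glOne`,
  `hasSatakeParamAt_detTwist_glOne`; L-algebraic since `ω` has trivial infinity type,
  `HeckeCharacter.IsFiniteOrder.isAlgebraic` with
  `exists_hasInfinityType_of_hasInfinityType_heckeCharacter_glOne`).

* `nonempty_localLanglandsDatum_of_reciprocityUpToIrreducibility` — the item inhabits
  `LocalLanglandsDatum (F_v)` for every completion of every number field (its `∃ Rec`), i.e. it is at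
  least as strong as the (undischarged) local Langlands correspondence for `GL_n` over these fields.

Together the first two certify, kernel-checked and in both directions, that the summit's normalisation
`arithFrobPolyOfSatake ι q_v 1 α` (geometric Frobenius ↔ uniformiser, no half-twist for
L-algebraic `π`) is the right one at `n = 1` — the case where a wrong Artin/Satake convention would
already be visible.  What is NOT here (and is the open content of the item): any `n ≥ 2`; the
local–global clause `LocalGlobalCompatibleAt` (it needs a `ReciprocityData`, whose local Langlands
data exist only through the undischarged named fact `LocalLanglandsDatum.nonempty`); the de Rham
clause at `v ∣ ℓ` (placeholder-typed `PstWeilDeligneData`); direction (B) for `ρ` of infinite order.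

No new definitions; axioms `propext`, `Classical.choice`, `Quot.sound`.
-/

noncomputable section

set_option linter.dupNamespace false -- project-wide option (lakefile weak.linter.dupNamespace); `Summit.Langlands.Langlands` is the mandated namespace

open scoped NumberField Classical Polynomial
open Filter IsDedekindDomain Polynomial
open Literature.NumberTheory.Automorphic Literature.NumberTheory.GaloisRepresentations

namespace Summit.Langlands.Langlands.Theorems.ReciprocityUpToIrreducibility

variable {K : Type} [Field K] [NumberField K] {ℓ : ℕ} [Fact ℓ.Prime]

/-- The places above `ℓ` are finitely many (Mathlib `Ideal.finite_factors`). [folklore] -/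
private theorem eventually_natCast_notMem_asIdeal₁ (K : Type) [Field K] [NumberField K] (ℓ : ℕ)
    [Fact ℓ.Prime] : ∀ᶠ v : HeightOneSpectrum (𝓞 K) in cofinite, ((ℓ : ℕ) : 𝓞 K) ∉ v.asIdeal := by
  have hne : Ideal.span {((ℓ : ℕ) : 𝓞 K)} ≠ ⊥ := by
    rw [Ne, Ideal.span_singleton_eq_bot]
    exact_mod_cast (Fact.out : ℓ.Prime).ne_zero
  refine Filter.mem_of_superset (Ideal.finite_factors hne).compl_mem_cofinite ?_
  intro v hv hmem
  exact hv (Ideal.dvd_span_singleton.2 hmem)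

/-- **Direction (A') of `ReciprocityUpToIrreducibility` at `n = 1`, Satake half (Weil 1956).**
For every number field `K`, every L-algebraic cuspidal automorphic representation `π` of
`GL₁(𝔸_K)` (Borel–Jacquet datum), every prime `ℓ` and `ι : ℚ̄_ℓ ≃+* ℂ` there is a continuous
`ρ : Γ_K → GL₁(ℚ̄_ℓ)` which is Satake–Frobenius compatible with `(π, ι)` in the summit's sense
(`SatakeFrobCompatibleAt ι π ρ v`: `π` has Satake parameter `α` at `v`, `ρ` is unramified at `v`,
and every arithmetic Frobenius at `v` has characteristic polynomial `arithFrobPolyOfSatake ι q_v 1 α`)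
at all but finitely many finite places `v`, and hence unramified almost everywhere.  Proof: the Hecke
character `χ_π` of `π` is algebraic (L-algebraic = C-algebraic for `n = 1`), Weil's `ℓ`-adic
character `ρ` of `χ_π` is unramified with `char(Frob_v) = X - ι⁻¹(χ_π(ϖ_v))⁻¹` at every `v ∤ ℓ`
where `χ_π` is unramified, `π` is unramified at all but finitely many `v` (Flath) and there
`χ_π` is unramified with Satake parameter `{χ_π(ϖ_v)}`.
[cite: Weil1956, §1–§2] [cite: BuzzardGeeLMS2014, Conj. 3.2.1 (case n = 1)] -/
theorem exists_satakeFrobCompatible_rankOne (hcpt : isCompact_glFiniteIntegralLevel 1 K)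
    (π : CuspidalAutomorphicRepData 1 K hcpt) (hL : π.1.IsLAlgebraic) (ι : PadicAlgCl ℓ ≃+* ℂ) :
    ∃ ρ : FramedGaloisRep K (PadicAlgCl ℓ) 1,
      (∀ᶠ v : HeightOneSpectrum (𝓞 K) in cofinite, SatakeFrobCompatibleAt ι π.1 ρ v) ∧
        ∀ᶠ v : HeightOneSpectrum (𝓞 K) in cofinite, ρ.IsUnramifiedAt v := by
  classical
  obtain ⟨χ, hχ⟩ := π.1.exists_heckeCharacter_glOne
  have halg : χ.IsAlgebraic :=
    π.1.isAlgebraic_heckeCharacter_glOne_of_isCAlgebraic hχ (hL.isCAlgebraic_of_odd odd_one)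
  obtain ⟨r, hr⟩ := halg.exists_lAdic ι
  have hunr : ∀ᶠ v : HeightOneSpectrum (𝓞 K) in cofinite, π.1.IsUnramifiedAt v :=
    π.1.hasSatakeParamAt_cofinite_holds
  have key : ∀ᶠ v : HeightOneSpectrum (𝓞 K) in cofinite, SatakeFrobCompatibleAt ι π.1 r v := by
    filter_upwards [eventually_natCast_notMem_asIdeal₁ K ℓ, hunr] with v hvℓ hv
    obtain ⟨α, hα⟩ := hv
    have hur : χ.IsUnramifiedAt v := π.1.isUnramifiedAt_heckeCharacter_glOne hχ hα
    obtain ⟨hunr, hfrob⟩ := hr v hvℓ hur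
    refine ⟨α, hα, hunr, ?_⟩
    obtain ⟨ϖ, hϖ, rfl⟩ := π.1.exists_eq_singleton_of_hasSatakeParamAt_glOne hχ hα
    have hc : ((χ (localUnits v ϖ) : ℂˣ) : ℂ) = χ.valueAtUniformizer v := by
      rw [← HeckeCharacter.localComponent_eq_valueAtUniformizer hur hϖ,
        HeckeCharacter.localComponent_apply]
    rw [arithFrobPolyOfSatake_one, Multiset.map_singleton, Multiset.prod_singleton, hc]
    exact hfrob
  exact ⟨r, key, key.mono fun v ⟨_, _, h, _⟩ => h⟩

/-- **Direction (B) of `ReciprocityUpToIrreducibility` at `n = 1` for characters of finite order,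
Satake half (Artin reciprocity).**  For every number field `K`, every prime `ℓ`, `ι : ℚ̄_ℓ ≃+* ℂ`
and every continuous `ρ : Γ_K → GL₁(ℚ̄_ℓ)` with open kernel (equivalently, of finite image) there
is an L-algebraic cuspidal automorphic representation `π` of `GL₁(𝔸_K)` (Borel–Jacquet datum)
which is Satake–Frobenius compatible with `ρ` in the summit's sense (`SatakeFrobCompatibleAt ι π ρ v`)
at all but finitely many finite places `v`.  Proof: `θ = (ι ∘ det ρ)⁻¹ : Γ_K → ℂˣ` has the open
kernel of `ρ`, so is a rank-one Artin representation `ψ`; by Artin's reciprocity law (proved in the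
tree, `artinReciprocity_character_holds`) there is a finite-order Hecke character `ω` with
`ω(ϖ_v) = ψ(Φ)` for the arithmetic Frobenii `Φ` at every `v` where `ψ` is unramified (all but
finitely many, `FramedArtinRep.eventually_isUnramifiedAt`); `π = π_ω = ℂ·(ω ∘ det)/⊥` is cuspidal
(`exists_cuspidal_detTwist_glOne`) with Satake parameter `{ω(ϖ_v)}` off a level of `ω`
(`hasSatakeParamAt_detTwist_glOne`), L-algebraic because `ω`, being of finite order, has infinity
type `(0, 0)` (`HeckeCharacter.IsFiniteOrder.isAlgebraic`,
`exists_hasInfinityType_of_hasInfinityType_heckeCharacter_glOne`); and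
`arithFrobPolyOfSatake ι q_v 1 {ω(ϖ_v)} = X - ι⁻¹(ω(ϖ_v))⁻¹ = X - ρ(Φ)`.
[cite: CasselsFrohlichANT1967, Ch. VII §5.1 Main Theorem (A), §4.2 Corollary]
[cite: BuzzardGeeLMS2014, Conj. 3.2.2 (case n = 1)] -/
theorem exists_cuspidal_satakeFrobCompatible_rankOne_of_isOpen_ker
    (hcpt : isCompact_glFiniteIntegralLevel 1 K) (ι : PadicAlgCl ℓ ≃+* ℂ)
    (ρ : FramedGaloisRep K (PadicAlgCl ℓ) 1)
    (hρ : IsOpen (ρ.toMonoidHom.ker : Set (Field.absoluteGaloisGroup K))) :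
    ∃ π : CuspidalAutomorphicRepData 1 K hcpt, π.1.IsLAlgebraic ∧
      ∀ᶠ v : HeightOneSpectrum (𝓞 K) in cofinite, SatakeFrobCompatibleAt ι π.1 ρ v := by
  classical
  -- (1) the complex character `θ = (ι ∘ det ρ)⁻¹ : Γ_K → ℂˣ`; it has the kernel of `ρ`
  set θ : Field.absoluteGaloisGroup K →* ℂˣ :=
    ((Units.map ((ι : PadicAlgCl ℓ ≃+* ℂ) : PadicAlgCl ℓ →* ℂ)).comp
      (FramedRep.det ρ).toMonoidHom)⁻¹ with hθdef
  have hθval' : ∀ σ : Field.absoluteGaloisGroup K, ((θ σ : ℂˣ) : ℂ) =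
      (ι ((FramedRep.det ρ σ : (PadicAlgCl ℓ)ˣ) : PadicAlgCl ℓ))⁻¹ := by
    intro σ
    simp only [hθdef, MonoidHom.inv_apply, MonoidHom.coe_comp, Function.comp_apply,
      Units.val_inv_eq_inv_val, Units.coe_map, MonoidHom.coe_coe]
    rfl
  have hdet : ∀ σ : Field.absoluteGaloisGroup K, ((FramedRep.det ρ σ : (PadicAlgCl ℓ)ˣ) : PadicAlgCl ℓ) =
      (((ρ σ : GL (Fin 1) (PadicAlgCl ℓ)) : Matrix (Fin 1) (Fin 1) (PadicAlgCl ℓ)) 0 0) := by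
    intro σ
    rw [FramedRep.det_apply, Matrix.GeneralLinearGroup.val_det_apply, Matrix.det_fin_one]
  have hθval : ∀ σ : Field.absoluteGaloisGroup K, ((θ σ : ℂˣ) : ℂ) =
      (ι (((ρ σ : GL (Fin 1) (PadicAlgCl ℓ)) : Matrix (Fin 1) (Fin 1) (PadicAlgCl ℓ)) 0 0))⁻¹ :=
    fun σ => by rw [hθval', hdet]
  have hθker : ∀ σ : Field.absoluteGaloisGroup K, θ σ = 1 ↔ ρ σ = 1 := by
    intro σ
    constructor
    · intro h
      have h1 : ((θ σ : ℂˣ) : ℂ) = 1 := by rw [h, Units.val_one]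
      rw [hθval, inv_eq_one] at h1
      have h2 : (((ρ σ : GL (Fin 1) (PadicAlgCl ℓ)) : Matrix (Fin 1) (Fin 1) (PadicAlgCl ℓ)) 0 0)
          = 1 := by
        have h3 := congrArg ι.symm h1
        rwa [RingEquiv.symm_apply_apply, map_one] at h3
      ext i j
      rw [Subsingleton.elim i 0, Subsingleton.elim j 0, h2, Units.val_one, Matrix.one_apply_eq]
    · intro h
      ext
      rw [hθval, h, Units.val_one, Matrix.one_apply_eq, map_one, inv_one, Units.val_one]
  have hθopen : IsOpen (θ.ker : Set (Field.absoluteGaloisGroup K)) := by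
    have h : (θ.ker : Set (Field.absoluteGaloisGroup K)) = ρ.toMonoidHom.ker := by
      ext σ
      simp only [SetLike.mem_coe, MonoidHom.mem_ker]
      exact hθker σ
    rw [h]
    exact hρ
  -- (2) the rank-one Artin representation `ψ = θ` and its reciprocity Hecke character `ω`
  set ψ : FramedArtinRep K 1 := FramedGaloisRep.ofOpenKer θ hθopen with hψdef
  obtain ⟨hωfin, hωspec⟩ := heckeOfArtinCharacter_spec artinReciprocity_character_holds ψ
  set ω : HeckeCharacter K := heckeOfArtinCharacter artinReciprocity_character_holds ψ with hωdef
  -- (3) the cuspidal automorphic representation `π_ω = ℂ·(ω∘det)/⊥` of `GL₁(𝔸_K)`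
  obtain ⟨π₀, hW, hW'⟩ := exists_automorphicRepData_detTwist_glOne hcpt ω
  have hcusp : π₀.W ≤ cuspFormsGL 1 K hcpt := by
    rw [hW, Submodule.span_le]
    rintro _ rfl
    exact IsCuspFormGL.mem_cuspFormsGL
      ⟨isAutomorphicForm_detTwist_glOne hcpt ω, fun k hk hk1 => absurd hk1 (by omega)⟩
  set π : CuspidalAutomorphicRepData 1 K hcpt := ⟨π₀, hcusp⟩ with hπdef
  -- `ω` is the Hecke character of `π_ω`: every `g` acts on `ℂ·(ω∘det)` by `ω(det g)`
  have hχ : ∀ (g : (AdelicGroupData.gl 1 K).Adelic), ∀ φ ∈ π.1.W,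
      rightTranslation (AdelicGroupData.gl 1 K) g φ -
        ((ω (Matrix.GeneralLinearGroup.det g) : ℂˣ) : ℂ) • φ ∈ π.1.W' := by
    intro g φ hφ
    change φ ∈ π₀.W at hφ
    rw [hW, Submodule.mem_span_singleton] at hφ
    obtain ⟨c, rfl⟩ := hφ
    rw [map_smul, rightTranslation_detTwist_glOne, detTwist_apply, smul_comm, sub_self]
    exact π.1.W'.zero_mem
  refine ⟨π, ?_, ?_⟩
  · -- `π_ω` is L-algebraic: `ω` has finite order, hence an infinity type `(p, q)` (= `(0, 0)`),
    -- and every infinity type of `π_ω` read off `ω` has integral exponents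
    obtain ⟨p, q, hpq⟩ := (ω.isAlgebraic_iff_exists_hasInfinityType).mp hωfin.isAlgebraic
    obtain ⟨T, hT, hTa⟩ :=
      π.1.exists_hasInfinityType_of_hasInfinityType_heckeCharacter_glOne hχ hpq
    refine ⟨T, hT, fun σ w hw => ?_⟩
    have ha : w.a = -((HeckeCharacter.embExponent p q σ : ℤ) : ℂ) := by
      have hmem : w.a ∈ (T σ).map ArchWeight.a := Multiset.mem_map_of_mem _ hw
      rw [hTa σ] at hmem
      exact Multiset.mem_singleton.mp hmem
    obtain ⟨m, hm⟩ := w.exists_int_sub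
    refine ⟨-HeckeCharacter.embExponent p q σ, -HeckeCharacter.embExponent p q σ - m, ?_, ?_⟩
    · rw [ha]
      push_cast
      ring
    · have hb : w.b = w.a - m := by rw [← hm]; ring
      rw [hb, ha]
      push_cast
      ring
  · -- (4) Satake–Frobenius compatibility at every `v` off a level of `ω` where `ψ` is unramified
    obtain ⟨𝔪, h𝔪, hω𝔪⟩ := HeckeCharacter.exists_level_glOne ω
    filter_upwards [(Ideal.finite_factors h𝔪).compl_mem_cofinite, ψ.eventually_isUnramifiedAt]
      with v hv hψv
    obtain ⟨-, hfrobψ⟩ := hωspec v hψv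
    have hsat : π.1.HasSatakeParamAt v {((ω (localUnits v (HeckeCharacter.uniformizer K v)) : ℂˣ) : ℂ)} :=
      AutomorphicRepData.hasSatakeParamAt_detTwist_glOne hcpt hW hW' h𝔪 hω𝔪 v hv
        (HeckeCharacter.valued_uniformizer (K := K) v)
    refine ⟨_, hsat, fun 𝔓 h𝔓 σ hσ => ?_, ?_⟩
    · -- `ρ` is unramified at `v`: same kernel as `ψ`
      have h := hψv 𝔓 h𝔓 σ hσ
      rw [hψdef, FramedGaloisRep.ofOpenKer_apply_eq_one_iff] at h
      exact (hθker σ).mp h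
    · -- the Frobenius polynomial `X - ι⁻¹(ω(ϖ_v))⁻¹ = X - ρ(Φ)`
      rw [arithFrobPolyOfSatake_one, Multiset.map_singleton, Multiset.prod_singleton]
      have hval : ((ω (localUnits v (HeckeCharacter.uniformizer K v)) : ℂˣ) : ℂ) =
          ω.valueAtUniformizer v := rfl
      rw [hval, FramedGaloisRep.hasFrobCharpolyAt_iff_of_rank_one]
      intro 𝔓 h𝔓 Φ hΦ
      have h := (FramedGaloisRep.hasFrobCharpolyAt_ofOpenKer_iff θ hθopen v _).mp hfrobψ 𝔓 h𝔓 Φ hΦ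
      rw [hθval] at h
      rw [← h, inv_inv, RingEquiv.symm_apply_apply]

/-- **A lower bound on the logical strength of the item: it names the local Langlands
correspondences of all completions.**  `ReciprocityUpToIrreducibility` begins `∀ F, ∃ Rec :
ReciprocityData F`, and a reciprocity datum carries a `LocalLanglandsDatum (F_v)` (Harris–Taylor's
`rec_v`, with its bijections `Irr(GL_m(F_v)) ≃ {Frobenius-semisimple WD representations}/≅` for all
`m`) at every finite place `v`; so any proof of the item inhabits `LocalLanglandsDatum (v.adicCompletion F)`
for every number field `F` and every `v` — in the present tree available only through the undischarged
named fact `LocalLanglandsDatum.nonempty` (`localLanglands_gl`, Harris–Taylor 2001 Thm. A / Henniart 2000,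
and Deligne's local constants).  Recorded to make the formal status of the item explicit: it cannot be
closed unconditionally before the local Langlands correspondence for `GL_n` is.
[cite: HarrisTaylorAMS2001, Thm. A] -/
theorem nonempty_localLanglandsDatum_of_reciprocityUpToIrreducibility
    (h : Summit.Langlands.Langlands.Theses.IrreducibilityBySelfDuality.ReciprocityUpToIrreducibility)
    (F : Type) [Field F] [NumberField F]
    (v : HeightOneSpectrum (𝓞 F)) : Nonempty (LocalLanglandsDatum (v.adicCompletion F)) := by
  obtain ⟨Rec, -⟩ := h F
  exact ⟨Rec.llc v⟩

end Summit.Langlands.Langlands.Theorems.ReciprocityUpToIrreducibility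

end
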